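import Summits.CriticalPhenomena.PercolationContinuityZ3.Theorems.PercNearOneGluingNoHeavyLowerTailCubicFourPointL1CertKernel
import HarnessLib

/-!
# MODE B, XV: kernel syntax for the (FX)/(FY) certificate replay (19 variables: 15 far cells + 4 near class variables)

Support file for the Sahi programme (`--supports stmt-CriticalPhenomena-4575`, prover prim-sahi-p2 gen 27).  No sorries, no named facts, no
`native_decide` (the COMPUTATIONAL check lives in `…IncStarTwoCutFXCert`).  Memo `…/FROM-prim-sahi-p2-gen27-BPLUS-GLUE-M8.md` §11–§13.

The exact q-uniform certificates of the far-side inequalities (FX), (FY) (kit j272205 / j272206) are identities between bihomogeneous polynomials of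
degree (3,3) in the 15 cells `f₀..f₁₄` of the partition lattice of the far points `(x,y,b,c) = (0,1,2,3)` (cell order of gen 26's `cells4.py`:
0 `x|y|b|c`, 1 `x|y|bc`, 2 `x|yb|c`, 3 `x|ybc`, 4 `x|yc|b`, 5 `xy|b|c`, 6 `xy|bc`, 7 `xyb|c`, 8 `xybc`, 9 `xyc|b`, 10 `xb|y|c`, 11 `xb|yc`, 12 `xbc|y`, 13 `xc|y|b`, 14 `xc|yb`
— variables `0..14`) and the near class variables `q0, qX, qY, qW` (variables `15..18`).  Rows (`FRow`): `prod P Q R S` = `m(P)m(Q) − m(R)m(S)` (15-bit cell masks: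
four-functions / BHK Thm 1.1 instances), `prodcq` = the same × `c_q`, `c_q = qW(q0+qX+qY+qW) − (qX+qW)(qY+qW)`, `e3 A B C` = the homogenised Sahi cubic of three cell
masks (`FourPointCert.e3E`: the two far stars and `σ·Cov(B_∪,C_∪)`), `one`/`onecq` (nonnegative monomials).  A block = row × list of `(coefficient, monomial)`;
`fcheckN pos neg bs` compares the normal forms (`Expr.toPoly`) of `Σpos − Σneg` and `Σ_blocks`; `denote_eq_of_fcheckN` is its soundness in every commutative ring.
-/

namespace Summit.CriticalPhenomena.PercolationContinuityZ3.Theorems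

namespace IncStarTwoCut.FXCert

open Lean.Grind.CommRing FourPointCert

/-- A certificate row over the 19 variables (see the module docstring). [this work] -/
inductive FRow where
  | one
  | onecq
  | prod (P Q R S : Nat)
  | prodcq (P Q R S : Nat)
  | e3 (A B C : Nat)
  deriving Repr, DecidableEq, Inhabited

/-- A row with its multiplier terms `(coefficient, monomial as a list of variable indices < 19)`. [this work] -/
structure FBlock where
  /-- the row -/
  row : FRow
  /-- multiplier terms -/
  mult : List (Nat × List Nat)
  deriving Repr, Inhabited

/-- `c_q = qW·(q0+qX+qY+qW) − (qX+qW)(qY+qW)` (Harris on the near class law). [this work] -/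
def cqE : Expr :=
  .sub (.mul (.var 18) (.add (.add (.add (.var 15) (.var 16)) (.var 17)) (.var 18)))
    (.mul (.add (.var 16) (.var 18)) (.add (.var 17) (.var 18)))

/-- The row polynomial. [this work] -/
def frowE : FRow → Expr
  | .one => .natCast 1
  | .onecq => cqE
  | .prod P Q R S => .sub (.mul (maskE P) (maskE Q)) (.mul (maskE R) (maskE S))
  | .prodcq P Q R S => .mul (.sub (.mul (maskE P) (maskE Q)) (.mul (maskE R) (maskE S))) cqE
  | .e3 A B C => e3E A B C

/-- The terms `(c · mono) · row` of one block. [this work] -/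
def fblockTermsE (b : FBlock) : List Expr := b.mult.map fun t => .mul (.mul (.natCast t.1) (monoE t.2)) (frowE b.row)

/-- All terms of a certificate. [this work] -/
def fcertTermsE : List FBlock → List Expr
  | [] => []
  | b :: bs => fblockTermsE b ++ fcertTermsE bs

/-- `Σ_blocks Σ_terms (c · mono) · row` as a balanced sum. [this work] -/
def fcertE (bs : List FBlock) : Expr := sumBal 20 (fcertTermsE bs)

/-- A signed target `Σ pos − Σ neg`, both lists of `(c, mono)`. [this work] -/
def ftargetE (pos neg : List (Nat × List Nat)) : Expr :=
  .sub (sumBal 20 (pos.map fun t => .mul (.natCast t.1) (monoE t.2))) (sumBal 20 (neg.map fun t => .mul (.natCast t.1) (monoE t.2)))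

/-- The computable check: the normal forms of target and certificate coincide. [this work] -/
def fcheckN (pos neg : List (Nat × List Nat)) (bs : List FBlock) : Bool :=
  (ftargetE pos neg).toPoly == (fcertE bs).toPoly

/-- Soundness of `fcheckN`: the identity holds in every commutative ring. [this work] -/
theorem denote_eq_of_fcheckN {α : Type} [Lean.Grind.CommRing α] (ctx : Context α) {pos neg : List (Nat × List Nat)} {bs : List FBlock}
    (h : fcheckN pos neg bs = true) : (ftargetE pos neg).denote ctx = (fcertE bs).denote ctx :=
  Expr.eq_of_toPoly_eq ctx _ _ h

end IncStarTwoCut.FXCert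

end Summit.CriticalPhenomena.PercolationContinuityZ3.Theorems
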